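import Summits.AtomisticToContinuum.Crystallization.Theorems.ExcessDecayLiouvilleComparisonBound

/-!
# Route `ExcessDecayLiouville`: the flux pairing with a decay-aware far field (nonlinear half, IV′)

Harmonic-replacement architecture for item `ExcessDecay` (stmt-AtomisticToContinuum-9334), nonlinear half.
`ExcessDecayLiouvilleComparisonBound.flux_pairing_le` bounds the far pairs of the flux pairing
`Σ_p Σ_{q≠p} ‖Φ p q‖ ‖w p − w q‖` through a crude sup bound `‖vt p − vt q‖ ≤ V`; at small scales of the
excess-decay iteration this loses powers of the outer radius.  Here the far pairs are bounded through the
VALUES of `vt` instead (`flux_pairing_le'`): with `B` the sites of the ball carrying the support of `w`,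

`ΣΣ ‖Φ‖‖Dw‖ ≤ 2Λ (4·10⁶ √NN[vt] √nnForm(w) + 2 F₈(L) Σ_B ‖vt‖‖w‖ + 2 Θ Σ_B ‖w‖)`,

where `Θ` bounds the far row sums `Σ_{q : dist p q > L} (dist p q)⁻⁸ ‖vt q‖` at the points of the ball and
`F₈(L) = 1024/((23/25)³ L⁵)`.  All `[folklore]`; helper lemmas, nothing here closes an item.
-/

noncomputable section

namespace Summit.AtomisticToContinuum.Crystallization.Theorems.ExcessDecayLiouville

open scoped BigOperators Topology InnerProductSpace RealInnerProductSpace Classical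
open Literature.MathematicalPhysics.StatisticalMechanics
open Summit.AtomisticToContinuum.Crystallization.Theorems.PhononStabilityNegative

section

variable {t : Fin 2 → (EuclideanSpace ℝ (Fin 3))} {A : (EuclideanSpace ℝ (Fin 3)) →L[ℝ] (EuclideanSpace ℝ (Fin 3))}

variable (hA : Adm₀ A) (hI : Inner₀ t A)

set_option quotPrecheck false in
-- Local notation: the finite near-neighbour form on the ball of radius `X` about `c`.
local notation "NN[" v ", " c ", " X "]" =>
  (∑ p ∈ (finite_sites_dist_le (t := t) (A := A) hA hI c X).toFinset,
    ∑ q ∈ (finite_sites_dist_le (t := t) (A := A) hA hI c X).toFinset,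
      (if p ≠ q ∧ dist p q ≤ 11 / 10 then ‖v p - v q‖ ^ 2 else (0 : ℝ)))

include hA hI in
/-- **The flux pairing against a localised test field, decay-aware far field**: for an antisymmetric flux
`‖Φ p q‖ ≤ Λ (dist p q)⁻⁸ ‖vt p − vt q‖` on `SR`, a test field `w` supported on the sites of `B_{ρ'}(c₀)`, and
far row sums `Σ_{q ∈ SR, dist p q > L} (dist p q)⁻⁸ ‖vt q‖ ≤ Θ` at the sites of that ball,
`Σ_p Σ_{q≠p} ‖Φ p q‖ ‖w p − w q‖ ≤ 2Λ (4·10⁶ √NN[vt, ρ'+10L+20] √nnForm(w) + 2F₈(L) Σ ‖vt‖‖w‖ + 2Θ Σ ‖w‖)`.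
[folklore] -/
theorem flux_pairing_le' {w vt : (EuclideanSpace ℝ (Fin 3)) → (EuclideanSpace ℝ (Fin 3))} (hw : (Function.support w).Finite)
    (SR : Finset (EuclideanSpace ℝ (Fin 3))) (hSRS : ∀ x ∈ SR, x ∈ Sites₀ t A)
    {c₀ : EuclideanSpace ℝ (Fin 3)} {ρ' : ℝ} (hwB : ∀ x, w x ≠ 0 → x ∈ SR ∧ dist x c₀ ≤ ρ')
    (Φ : (EuclideanSpace ℝ (Fin 3)) → (EuclideanSpace ℝ (Fin 3)) → (EuclideanSpace ℝ (Fin 3)))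
    (hanti : ∀ p ∈ SR, ∀ q ∈ SR, Φ q p = -Φ p q) {Λ Θ L : ℝ} (hΛ : 0 ≤ Λ) (hΘ0 : 0 ≤ Θ) (hL : 1 ≤ L)
    (hΦ : ∀ p ∈ SR, ∀ q ∈ SR, p ≠ q → ‖Φ p q‖ ≤ Λ * (dist p q)⁻¹ ^ 8 * ‖vt p - vt q‖)
    (hΘ : ∀ p ∈ SR, dist p c₀ ≤ ρ' →
      ∑ q ∈ (SR.erase p).filter (fun q => ¬ dist p q ≤ L), (dist p q)⁻¹ ^ 8 * ‖vt q‖ ≤ Θ) :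
    ∑ p ∈ SR, ∑ q ∈ SR.erase p, ‖Φ p q‖ * ‖w p - w q‖ ≤
      2 * Λ * (4000000 * Real.sqrt (NN[vt, c₀, ρ' + 10 * L + 20]) * Real.sqrt (nnForm t A w) +
        2 * (1024 / ((23 / 25 : ℝ) ^ 3 * L ^ 5)) * ∑ x ∈ SR, ‖vt x‖ * ‖w x‖ + 2 * Θ * ∑ x ∈ SR, ‖w x‖) := by
  classical
  set B := SR.filter (fun p => dist p c₀ ≤ ρ') with hB
  have hBT : B ⊆ SR := Finset.filter_subset _ _
  have hwB' : ∀ x, x ∉ B → w x = 0 := by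
    intro x hx; by_contra h; exact hx (by rw [hB, Finset.mem_filter]; exact hwB x h)
  -- (1) reduce to the rows of `B`
  have hred := sum_pairs_le_two_mul_rows SR B hBT (fun p q => ‖Φ p q‖ * ‖w p - w q‖)
    (fun p hp q hq => by
      show ‖Φ p q‖ * ‖w p - w q‖ = ‖Φ q p‖ * ‖w q - w p‖
      rw [hanti p hp q hq, norm_neg, norm_sub_rev])
    (fun p q => by positivity)
    (fun p hp q hq hpB hqB => by simp [hwB' p hpB, hwB' q hqB])
  refine hred.trans ?_
  rw [mul_assoc (2 : ℝ) Λ, mul_assoc (2 : ℝ)]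
  refine mul_le_mul_of_nonneg_left ?_ (by norm_num)
  -- (2) bound the rows: split each row into near and far pairs
  have hrow : ∀ p ∈ B, ∑ q ∈ SR.erase p, ‖Φ p q‖ * ‖w p - w q‖ ≤
      Λ * (∑ q ∈ (SR.erase p).filter (fun q => dist p q ≤ L), (dist p q)⁻¹ ^ 8 * ‖vt p - vt q‖ * ‖w p - w q‖) +
      Λ * (∑ q ∈ (SR.erase p).filter (fun q => ¬ dist p q ≤ L),
        (dist p q)⁻¹ ^ 8 * ((‖vt p‖ * ‖w p‖ + ‖vt q‖ * ‖w q‖) + (‖w p‖ * ‖vt q‖ + ‖vt p‖ * ‖w q‖))) := by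
    intro p hp
    have hpS := hBT hp
    rw [← Finset.sum_filter_add_sum_filter_not (SR.erase p) (fun q => dist p q ≤ L), Finset.mul_sum, Finset.mul_sum]
    refine add_le_add (Finset.sum_le_sum fun q hq => ?_) (Finset.sum_le_sum fun q hq => ?_)
    · obtain ⟨hq, -⟩ := Finset.mem_filter.1 hq
      obtain ⟨hne, hqS⟩ := Finset.mem_erase.1 hq
      have := hΦ p hpS q hqS (Ne.symm hne)
      calc ‖Φ p q‖ * ‖w p - w q‖ ≤ (Λ * (dist p q)⁻¹ ^ 8 * ‖vt p - vt q‖) * ‖w p - w q‖ :=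
            mul_le_mul_of_nonneg_right this (norm_nonneg _)
        _ = Λ * ((dist p q)⁻¹ ^ 8 * ‖vt p - vt q‖ * ‖w p - w q‖) := by ring
    · obtain ⟨hq, -⟩ := Finset.mem_filter.1 hq
      obtain ⟨hne, hqS⟩ := Finset.mem_erase.1 hq
      have h1 := hΦ p hpS q hqS (Ne.symm hne)
      have h2 : ‖vt p - vt q‖ ≤ ‖vt p‖ + ‖vt q‖ := norm_sub_le _ _
      have h3 : ‖w p - w q‖ ≤ ‖w p‖ + ‖w q‖ := norm_sub_le _ _
      have h4 : 0 ≤ (dist p q)⁻¹ ^ 8 := by positivity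
      calc ‖Φ p q‖ * ‖w p - w q‖ ≤ (Λ * (dist p q)⁻¹ ^ 8 * ‖vt p - vt q‖) * (‖w p‖ + ‖w q‖) :=
            mul_le_mul h1 h3 (norm_nonneg _) (by positivity)
        _ ≤ (Λ * (dist p q)⁻¹ ^ 8 * (‖vt p‖ + ‖vt q‖)) * (‖w p‖ + ‖w q‖) := by gcongr
        _ = Λ * ((dist p q)⁻¹ ^ 8 * ((‖vt p‖ * ‖w p‖ + ‖vt q‖ * ‖w q‖) + (‖w p‖ * ‖vt q‖ + ‖vt p‖ * ‖w q‖))) := by ring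
  refine (Finset.sum_le_sum hrow).trans ?_
  rw [Finset.sum_add_distrib, ← Finset.mul_sum, ← Finset.mul_sum, ← mul_add]
  refine mul_le_mul_of_nonneg_left ?_ hΛ
  rw [add_assoc]
  refine add_le_add ?_ ?_
  · -- (3) the near pairs: Cauchy–Schwarz and the localised long-range estimate, twice
    have hCS := sum_sum_weight_mul_le B (fun p => (SR.erase p).filter (fun q => dist p q ≤ L))
      (ω := fun p q => (dist p q)⁻¹ ^ 8) (a := fun p q => ‖vt p - vt q‖) (b := fun p q => ‖w p - w q‖)
      (fun p q => by positivity) (fun p q => norm_nonneg _) (fun p q => norm_nonneg _)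
    refine hCS.trans ?_
    have hsub1 : B ⊆ (finite_sites_dist_le (t := t) (A := A) hA hI c₀ ρ').toFinset := by
      intro p hp
      rw [hB, Finset.mem_filter] at hp
      exact (Set.Finite.mem_toFinset _).2 ⟨hSRS p hp.1, hp.2⟩
    have hsub2 : ∀ p ∈ B, (SR.erase p).filter (fun q => dist p q ≤ L) ⊆
        (finite_sites_dist_le (t := t) (A := A) hA hI c₀ (ρ' + L)).toFinset := by
      intro p hp q hq
      rw [hB, Finset.mem_filter] at hp
      obtain ⟨hq, hqL⟩ := Finset.mem_filter.1 hq
      refine (Set.Finite.mem_toFinset _).2 ⟨hSRS q (Finset.mem_erase.1 hq).2, ?_⟩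
      have := dist_triangle q p c₀
      rw [dist_comm q p] at this
      linarith
    have hLR : ∀ (f : (EuclideanSpace ℝ (Fin 3)) → (EuclideanSpace ℝ (Fin 3))),
        ∑ p ∈ B, ∑ q ∈ (SR.erase p).filter (fun q => dist p q ≤ L), (dist p q)⁻¹ ^ 8 * ‖f p - f q‖ ^ 2 ≤
          4000000 * NN[f, c₀, ρ' + 10 * L + 20] := by
      intro f
      refine le_trans ?_ (longRange_local_le hA hI f c₀ (R := ρ') hL)
      refine le_trans (Finset.sum_le_sum fun p hp => ?_)
        (Finset.sum_le_sum_of_subset_of_nonneg hsub1 fun p _ _ => Finset.sum_nonneg fun q _ => by positivity)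
      refine le_trans (Finset.sum_le_sum fun q hq => ?_)
        (Finset.sum_le_sum_of_subset_of_nonneg (hsub2 p hp) fun q _ _ => by positivity)
      obtain ⟨hq, hqL⟩ := Finset.mem_filter.1 hq
      rw [if_pos ⟨Ne.symm (Finset.mem_erase.1 hq).1, hqL⟩]
    have h1 := hLR vt
    have h2 := (hLR w).trans (mul_le_mul_of_nonneg_left (NN_le_nnForm hA hI hw c₀ _) (by norm_num))
    have hs1 := Real.sqrt_le_sqrt h1
    have hs2 := Real.sqrt_le_sqrt h2
    rw [Real.sqrt_mul (by norm_num), show Real.sqrt (4000000 : ℝ) = 2000 by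
      rw [show (4000000 : ℝ) = 2000 ^ 2 by norm_num, Real.sqrt_sq (by norm_num)]] at hs1 hs2
    calc _ ≤ (2000 * Real.sqrt (NN[vt, c₀, ρ' + 10 * L + 20])) * (2000 * Real.sqrt (nnForm t A w)) :=
          mul_le_mul hs1 hs2 (Real.sqrt_nonneg _) (by positivity)
      _ = 4000000 * Real.sqrt (NN[vt, c₀, ρ' + 10 * L + 20]) * Real.sqrt (nnForm t A w) := by ring
  · -- (4) the far pairs, through the values of `vt`
    have hL0 : 23 / 25 ≤ L := by linarith
    have hfar : ∀ p ∈ SR, ∑ q ∈ (SR.erase p).filter (fun q => ¬ dist p q ≤ L), (dist p q)⁻¹ ^ 8 ≤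
        1024 / ((23 / 25 : ℝ) ^ 3 * L ^ 5) := by
      intro p hp
      obtain ⟨hs, hle⟩ := summable_far_inv_pow_eight_sites hA hI p hL0
      refine le_trans ?_ hle
      have hmem : ∀ x ∈ (SR.erase p).filter (fun q => ¬ dist p q ≤ L), x ∈ Sites₀ t A := fun x hx =>
        hSRS x (Finset.mem_erase.1 (Finset.mem_filter.1 hx).1).2
      rw [← Finset.sum_subtype_of_mem (f := fun q => (dist p q)⁻¹ ^ 8) hmem]
      refine le_trans (Finset.sum_le_sum fun q hq => ?_) (hs.sum_le_tsum _ fun q _ => by positivity)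
      have hq' := (Finset.mem_subtype.1 hq)
      obtain ⟨-, hqL⟩ := Finset.mem_filter.1 hq'
      rw [if_pos (by rw [dist_comm]; exact lt_of_not_ge hqL), dist_comm]
    generalize hF : (1024 / ((23 / 25 : ℝ) ^ 3 * L ^ 5)) = F₈ at hfar
    have hF0 : 0 ≤ F₈ := by rw [← hF]; positivity
    -- split the four products
    have hsplit : ∑ p ∈ B, ∑ q ∈ (SR.erase p).filter (fun q => ¬ dist p q ≤ L),
        (dist p q)⁻¹ ^ 8 * ((‖vt p‖ * ‖w p‖ + ‖vt q‖ * ‖w q‖) + (‖w p‖ * ‖vt q‖ + ‖vt p‖ * ‖w q‖)) =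
        (∑ p ∈ B, (‖vt p‖ * ‖w p‖) * ∑ q ∈ (SR.erase p).filter (fun q => ¬ dist p q ≤ L), (dist p q)⁻¹ ^ 8 +
          ∑ p ∈ B, ∑ q ∈ (SR.erase p).filter (fun q => ¬ dist p q ≤ L), (dist p q)⁻¹ ^ 8 * (‖vt q‖ * ‖w q‖)) +
        (∑ p ∈ B, ‖w p‖ * ∑ q ∈ (SR.erase p).filter (fun q => ¬ dist p q ≤ L), (dist p q)⁻¹ ^ 8 * ‖vt q‖ +
          ∑ p ∈ B, ‖vt p‖ * ∑ q ∈ (SR.erase p).filter (fun q => ¬ dist p q ≤ L), (dist p q)⁻¹ ^ 8 * ‖w q‖) := by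
      rw [← Finset.sum_add_distrib, ← Finset.sum_add_distrib, ← Finset.sum_add_distrib]
      refine Finset.sum_congr rfl fun p _ => ?_
      rw [Finset.mul_sum, Finset.mul_sum, Finset.mul_sum, ← Finset.sum_add_distrib, ← Finset.sum_add_distrib,
        ← Finset.sum_add_distrib]
      refine Finset.sum_congr rfl fun q _ => ?_
      ring
    rw [hsplit]
    -- the generic swap: a column-weighted far sum over the rows of `B` is a row sum seen from the column
    have hswap : ∀ (g : (EuclideanSpace ℝ (Fin 3)) → ℝ), (∀ x, 0 ≤ g x) → (∀ x, x ∉ B → g x = 0) →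
        ∑ p ∈ B, ∑ q ∈ (SR.erase p).filter (fun q => ¬ dist p q ≤ L), (dist p q)⁻¹ ^ 8 * g q ≤
          ∑ q ∈ B, g q * ∑ p ∈ (SR.erase q).filter (fun p => ¬ dist q p ≤ L), (dist q p)⁻¹ ^ 8 := by
      intro g hg0 hgB
      calc _ ≤ ∑ p ∈ SR, ∑ q ∈ SR.erase p, (if ¬ dist p q ≤ L then (dist p q)⁻¹ ^ 8 * g q else 0) := by
            refine le_trans (Finset.sum_le_sum fun p _ => ?_)
              (Finset.sum_le_sum_of_subset_of_nonneg hBT fun p _ _ => Finset.sum_nonneg fun q _ => by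
                split_ifs <;> [exact le_rfl; exact mul_nonneg (by positivity) (hg0 q)])
            rw [Finset.sum_filter]
        _ = ∑ q ∈ SR, ∑ p ∈ SR.erase q, (if ¬ dist p q ≤ L then (dist p q)⁻¹ ^ 8 * g q else 0) :=
            sum_sum_erase_comm SR _
        _ = ∑ q ∈ SR, g q * ∑ p ∈ (SR.erase q).filter (fun p => ¬ dist q p ≤ L), (dist q p)⁻¹ ^ 8 := by
            refine Finset.sum_congr rfl fun q _ => ?_
            rw [Finset.mul_sum, Finset.sum_filter]
            refine Finset.sum_congr rfl fun p _ => ?_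
            rw [dist_comm p q]
            split_ifs <;> ring
        _ = ∑ q ∈ B, g q * ∑ p ∈ (SR.erase q).filter (fun p => ¬ dist q p ≤ L), (dist q p)⁻¹ ^ 8 := by
            symm
            refine Finset.sum_subset hBT fun q _ hqB => ?_
            rw [hgB q hqB, zero_mul]
    -- T1 + T2 ≤ 2 F₈ Σ ‖vt‖‖w‖
    have hT1 : ∑ p ∈ B, (‖vt p‖ * ‖w p‖) * ∑ q ∈ (SR.erase p).filter (fun q => ¬ dist p q ≤ L), (dist p q)⁻¹ ^ 8 ≤
        F₈ * ∑ x ∈ SR, ‖vt x‖ * ‖w x‖ := by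
      calc _ ≤ ∑ p ∈ B, (‖vt p‖ * ‖w p‖) * F₈ :=
            Finset.sum_le_sum fun p hp => mul_le_mul_of_nonneg_left (hfar p (hBT hp)) (by positivity)
        _ = F₈ * ∑ p ∈ B, ‖vt p‖ * ‖w p‖ := by rw [Finset.mul_sum]; exact Finset.sum_congr rfl fun _ _ => mul_comm _ _
        _ ≤ F₈ * ∑ x ∈ SR, ‖vt x‖ * ‖w x‖ :=
            mul_le_mul_of_nonneg_left (Finset.sum_le_sum_of_subset_of_nonneg hBT fun _ _ _ => by positivity) hF0
    have hT2 : ∑ p ∈ B, ∑ q ∈ (SR.erase p).filter (fun q => ¬ dist p q ≤ L), (dist p q)⁻¹ ^ 8 * (‖vt q‖ * ‖w q‖) ≤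
        F₈ * ∑ x ∈ SR, ‖vt x‖ * ‖w x‖ := by
      refine (hswap (fun q => ‖vt q‖ * ‖w q‖) (fun x => by positivity) (fun x hx => by rw [hwB' x hx]; simp)).trans ?_
      calc _ ≤ ∑ q ∈ B, (‖vt q‖ * ‖w q‖) * F₈ :=
            Finset.sum_le_sum fun q hq => mul_le_mul_of_nonneg_left (hfar q (hBT hq)) (by positivity)
        _ = F₈ * ∑ q ∈ B, ‖vt q‖ * ‖w q‖ := by rw [Finset.mul_sum]; exact Finset.sum_congr rfl fun _ _ => mul_comm _ _
        _ ≤ F₈ * ∑ x ∈ SR, ‖vt x‖ * ‖w x‖ :=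
            mul_le_mul_of_nonneg_left (Finset.sum_le_sum_of_subset_of_nonneg hBT fun _ _ _ => by positivity) hF0
    -- T3 + T4 ≤ 2 Θ Σ ‖w‖
    have hBmem : ∀ p ∈ B, p ∈ SR ∧ dist p c₀ ≤ ρ' := fun p hp => by rw [hB, Finset.mem_filter] at hp; exact hp
    have hT3 : ∑ p ∈ B, ‖w p‖ * ∑ q ∈ (SR.erase p).filter (fun q => ¬ dist p q ≤ L), (dist p q)⁻¹ ^ 8 * ‖vt q‖ ≤
        Θ * ∑ x ∈ SR, ‖w x‖ := by
      calc _ ≤ ∑ p ∈ B, ‖w p‖ * Θ :=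
            Finset.sum_le_sum fun p hp => mul_le_mul_of_nonneg_left (hΘ p (hBmem p hp).1 (hBmem p hp).2) (norm_nonneg _)
        _ = Θ * ∑ p ∈ B, ‖w p‖ := by rw [Finset.mul_sum]; exact Finset.sum_congr rfl fun _ _ => mul_comm _ _
        _ ≤ Θ * ∑ x ∈ SR, ‖w x‖ :=
            mul_le_mul_of_nonneg_left (Finset.sum_le_sum_of_subset_of_nonneg hBT fun _ _ _ => norm_nonneg _) hΘ0
    have hT4 : ∑ p ∈ B, ‖vt p‖ * ∑ q ∈ (SR.erase p).filter (fun q => ¬ dist p q ≤ L), (dist p q)⁻¹ ^ 8 * ‖w q‖ ≤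
        Θ * ∑ x ∈ SR, ‖w x‖ := by
      -- rewrite as a double sum with the product inside, swap, and use `hΘ` at the column point
      have e1 : ∑ p ∈ B, ‖vt p‖ * ∑ q ∈ (SR.erase p).filter (fun q => ¬ dist p q ≤ L), (dist p q)⁻¹ ^ 8 * ‖w q‖ =
          ∑ p ∈ B, ∑ q ∈ (SR.erase p).filter (fun q => ¬ dist p q ≤ L), (dist p q)⁻¹ ^ 8 * ‖vt p‖ * ‖w q‖ := by
        refine Finset.sum_congr rfl fun p _ => ?_
        rw [Finset.mul_sum]
        exact Finset.sum_congr rfl fun q _ => by ring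
      rw [e1]
      calc _ ≤ ∑ p ∈ SR, ∑ q ∈ SR.erase p, (if ¬ dist p q ≤ L then (dist p q)⁻¹ ^ 8 * ‖vt p‖ * ‖w q‖ else 0) := by
            refine le_trans (Finset.sum_le_sum fun p _ => ?_)
              (Finset.sum_le_sum_of_subset_of_nonneg hBT fun p _ _ => Finset.sum_nonneg fun q _ => by positivity)
            rw [Finset.sum_filter]
        _ = ∑ q ∈ SR, ∑ p ∈ SR.erase q, (if ¬ dist p q ≤ L then (dist p q)⁻¹ ^ 8 * ‖vt p‖ * ‖w q‖ else 0) :=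
            sum_sum_erase_comm SR _
        _ = ∑ q ∈ SR, ‖w q‖ * ∑ p ∈ (SR.erase q).filter (fun p => ¬ dist q p ≤ L), (dist q p)⁻¹ ^ 8 * ‖vt p‖ := by
            refine Finset.sum_congr rfl fun q _ => ?_
            rw [Finset.mul_sum, Finset.sum_filter]
            refine Finset.sum_congr rfl fun p _ => ?_
            rw [dist_comm p q]
            split_ifs <;> ring
        _ = ∑ q ∈ B, ‖w q‖ * ∑ p ∈ (SR.erase q).filter (fun p => ¬ dist q p ≤ L), (dist q p)⁻¹ ^ 8 * ‖vt p‖ := by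
            symm
            refine Finset.sum_subset hBT fun q _ hqB => ?_
            rw [hwB' q hqB, norm_zero, zero_mul]
        _ ≤ ∑ q ∈ B, ‖w q‖ * Θ :=
            Finset.sum_le_sum fun q hq => mul_le_mul_of_nonneg_left (hΘ q (hBmem q hq).1 (hBmem q hq).2) (norm_nonneg _)
        _ = Θ * ∑ q ∈ B, ‖w q‖ := by rw [Finset.mul_sum]; exact Finset.sum_congr rfl fun _ _ => mul_comm _ _
        _ ≤ Θ * ∑ x ∈ SR, ‖w x‖ :=
            mul_le_mul_of_nonneg_left (Finset.sum_le_sum_of_subset_of_nonneg hBT fun _ _ _ => norm_nonneg _) hΘ0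
    linarith [hT1, hT2, hT3, hT4]

end

end Summit.AtomisticToContinuum.Crystallization.Theorems.ExcessDecayLiouville

end
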